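import Summits.HubbardSuperconductivity.HubbardSuperconductivity.Theorems.WeakCouplingBCSKlLindhardEnclosureHyperbolaCore
import Summits.HubbardSuperconductivity.HubbardSuperconductivity.Theorems.WeakCouplingBCSKlLindhardEnclosurePieces

/-!
# KL-MARGIN-SCAN reader (22) «kernel-lindhard-enclosure» — the 2-D MAJORISED-HYPERBOLA variant `vAB`: core theorem

Kernel-data-agnostic core of `Params.ceilBdry`'s 2-D variant: the straddler's abscissa-cosine range `[αLo, αUp]/2^40` is cut into
`MA = 8` pieces at `linGridZ αLo αUp MA m`; on piece `m` the slope floor is `Smin_m = min(sDnZ α_m, sDnZ α_{m+1})` and the crescent extent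
`Lm_m = extentZ far α_m α_{m+1} βLo βUp`; the kernel's piece value is
`bdryPieceUp (!far) Vlo α_m α_{m+1} βLo βUp = cdivZ ((α_{m+1} − α_m)·logUpZ (cdivZ (Smin_m·Lm_m) Vlo)) Smin_m` and
`vAB = cdivZ (2^30·10⁸·Σ_m piece_m) (τx·τy·D)`.  Given (H1) piecewise strip domination by the crescent majorant with the piece data,
(H2) the ordinate cosine range and sine floor `τy/10⁴`, (H2x) the abscissa cosine range `[αLo, αUp]/2^40` and sine floor `τx/10⁴`,
(H3) piecewise crescent extents, `vAB` is a certified ceiling of the cell (`…Pieces.pieces_strip_lemma` per strip bound from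
`…Crescent.strip_inner_le`, then per-piece outward rounding).  Honest framing: nothing in this file asserts a KL margin at any `t′ ≠ 0`, `K₃`,
`U₀`, the window or B1g dominance; a Kohn–Luttinger instability statement is not ODLRO and nothing here proves superconductivity in the
Hubbard model.  (p1 g26, 2026-08-29.)
-/

noncomputable section

set_option linter.dupNamespace false

namespace Summit.HubbardSuperconductivity.HubbardSuperconductivity.Theorems.KlLindhardEnclosure

open Real Set MeasureTheory Finset Literature.MathematicalPhysics.QuantumLattice
open Summit.HubbardSuperconductivity.HubbardSuperconductivity.Theorems

/-! ## §1 Integer helpers -/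

/-- The kernel's piece value in terms of `extentZ`. -/
theorem Params.bdryPieceUp_eq (P : Params) (far : Bool) (Vlo α0 α1 βLo βUp : ℤ) :
    P.bdryPieceUp (!far) Vlo α0 α1 βLo βUp =
      if 0 < min (P.sDnZ α0) (P.sDnZ α1) then
        cdivZ ((α1 - α0) * logUpZ (cdivZ (min (P.sDnZ α0) (P.sDnZ α1) * P.extentZ far α0 α1 βLo βUp) Vlo)) (min (P.sDnZ α0) (P.sDnZ α1))
      else 0 := by
  simp only [Params.bdryPieceUp, Params.extentZ]

/-- `sDnZ` is monotone or antitone in its argument, hence between two points it is at least the smaller end value. -/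
theorem Params.sDnZ_between (P : Params) (htpD : 0 < P.tpD) {lo hi a : ℤ} (h0 : lo ≤ a) (h1 : a ≤ hi) :
    min (P.sDnZ lo) (P.sDnZ hi) ≤ P.sDnZ a := by
  simp only [Params.sDnZ, fdivZ]
  rcases le_or_gt 0 P.tpN with ht | ht
  · have : 2 * D * P.tpD + 4 * P.tpN * lo ≤ 2 * D * P.tpD + 4 * P.tpN * a := by nlinarith
    exact (min_le_left _ _).trans (Int.ediv_le_ediv htpD this)
  · have : 2 * D * P.tpD + 4 * P.tpN * hi ≤ 2 * D * P.tpD + 4 * P.tpN * a := by nlinarith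
    exact (min_le_right _ _).trans (Int.ediv_le_ediv htpD this)

/-- List sum over `List.range` as a `Finset.range` sum. -/
theorem list_range_map_sum (f : ℕ → ℤ) (n : ℕ) : ((List.range n).map f).sum = ∑ m ∈ Finset.range n, f m := by
  induction n with
  | zero => simp
  | succ n ih => rw [List.range_succ, List.map_append, List.sum_append, ih, Finset.sum_range_succ]; simp

/-- The log of the piece data is majorised by `logUpZ (cdivZ (S·L) V)/2^40`, and is non-negative. -/
theorem log_piece_le {Smin Vlo Lm : ℤ} (hS : 0 < Smin) (hV : 0 < Vlo) (hL : 0 ≤ Lm) :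
    0 ≤ Real.log (1 + ((Smin : ℤ) : ℝ) / 2 ^ 40 * (((Lm : ℤ) : ℝ) / 2 ^ 40) / (((Vlo : ℤ) : ℝ) / 2 ^ 40)) ∧
    Real.log (1 + ((Smin : ℤ) : ℝ) / 2 ^ 40 * (((Lm : ℤ) : ℝ) / 2 ^ 40) / (((Vlo : ℤ) : ℝ) / 2 ^ 40))
      ≤ ((logUpZ (cdivZ (Smin * Lm) Vlo) : ℤ) : ℝ) / 2 ^ 40 := by
  have hS' : (0 : ℝ) < ((Smin : ℤ) : ℝ) := by exact_mod_cast hS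
  have hV' : (0 : ℝ) < ((Vlo : ℤ) : ℝ) := by exact_mod_cast hV
  have hL' : (0 : ℝ) ≤ ((Lm : ℤ) : ℝ) := by exact_mod_cast hL
  set Z := cdivZ (Smin * Lm) Vlo with hZ
  have hZ0 : 0 ≤ Z := cdivZ_nonneg (mul_nonneg hS.le hL) hV
  have hZge : ((Smin : ℤ) : ℝ) * ((Lm : ℤ) : ℝ) / ((Vlo : ℤ) : ℝ) ≤ ((Z : ℤ) : ℝ) := by
    have h := div_le_cdivZ (Smin * Lm) Vlo hV
    have h' := (Rat.cast_le (K := ℝ)).mpr h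
    push_cast at h'
    rw [hZ]; exact_mod_cast h'
  have e : ((Smin : ℤ) : ℝ) / 2 ^ 40 * (((Lm : ℤ) : ℝ) / 2 ^ 40) / (((Vlo : ℤ) : ℝ) / 2 ^ 40)
      = (((Smin : ℤ) : ℝ) * ((Lm : ℤ) : ℝ) / ((Vlo : ℤ) : ℝ)) / 2 ^ 40 := by
    field_simp
  have hnn : 0 ≤ ((Smin : ℤ) : ℝ) * ((Lm : ℤ) : ℝ) / ((Vlo : ℤ) : ℝ) := by positivity
  rw [e]
  constructor
  · apply Real.log_nonneg; have : 0 ≤ (((Smin : ℤ) : ℝ) * ((Lm : ℤ) : ℝ) / ((Vlo : ℤ) : ℝ)) / 2 ^ 40 := by positivity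
    linarith
  · have h1 := le_logUpZ hZ0
    rw [le_div_iff₀ (by positivity)]
    refine le_trans ?_ h1
    rw [mul_comm]
    apply mul_le_mul_of_nonneg_left _ (by positivity)
    apply Real.log_le_log (by positivity)
    have := div_le_div_of_nonneg_right hZge (by positivity : (0 : ℝ) ≤ 2 ^ 40); linarith

/-- **PER-PIECE ROUNDING**: `((α1−α0)/2^40)·(Smin/2^40)⁻¹·log(…) ≤ cdivZ ((α1−α0)·logUpZ Z) Smin / 2^40`. -/
theorem piece_rounding {α0 α1 Smin Vlo Lm : ℤ} (h01 : α0 ≤ α1) (hS : 0 < Smin) (hV : 0 < Vlo) (hL : 0 ≤ Lm) :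
    ((α1 - α0 : ℤ) : ℝ) / 2 ^ 40 * (((((Smin : ℤ) : ℝ) / 2 ^ 40))⁻¹ *
      Real.log (1 + ((Smin : ℤ) : ℝ) / 2 ^ 40 * (((Lm : ℤ) : ℝ) / 2 ^ 40) / (((Vlo : ℤ) : ℝ) / 2 ^ 40))) ≤
    ((cdivZ ((α1 - α0) * logUpZ (cdivZ (Smin * Lm) Vlo)) Smin : ℤ) : ℝ) / 2 ^ 40 := by
  have hS' : (0 : ℝ) < ((Smin : ℤ) : ℝ) := by exact_mod_cast hS
  have h01' : (0 : ℝ) ≤ ((α1 - α0 : ℤ) : ℝ) := by exact_mod_cast (sub_nonneg.mpr h01)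
  obtain ⟨hlog0, hlog⟩ := log_piece_le hS hV hL
  have rc := div_le_cdivZ ((α1 - α0) * logUpZ (cdivZ (Smin * Lm) Vlo)) Smin hS
  have rc' := (Rat.cast_le (K := ℝ)).mpr rc
  simp only [Rat.cast_div, Rat.cast_intCast] at rc'
  have rc'' : ((((α1 - α0) * logUpZ (cdivZ (Smin * Lm) Vlo) : ℤ) : ℝ) / ((Smin : ℤ) : ℝ)) / 2 ^ 40 ≤
      ((cdivZ ((α1 - α0) * logUpZ (cdivZ (Smin * Lm) Vlo)) Smin : ℤ) : ℝ) / 2 ^ 40 :=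
    div_le_div_of_nonneg_right rc' (by positivity)
  refine le_trans ?_ rc''
  push_cast
  -- (α1−α0)/D · (D/Smin) · log ≤ (α1−α0) · (logUpZ/D)... = ((α1−α0) logUpZ / Smin)/D
  have e : ((α1 : ℝ) - (α0 : ℝ)) / 2 ^ 40 * (((((Smin : ℤ) : ℝ) / 2 ^ 40))⁻¹ *
      Real.log (1 + ((Smin : ℤ) : ℝ) / 2 ^ 40 * (((Lm : ℤ) : ℝ) / 2 ^ 40) / (((Vlo : ℤ) : ℝ) / 2 ^ 40)))
      = ((α1 : ℝ) - (α0 : ℝ)) * Real.log (1 + ((Smin : ℤ) : ℝ) / 2 ^ 40 * (((Lm : ℤ) : ℝ) / 2 ^ 40) / (((Vlo : ℤ) : ℝ) / 2 ^ 40))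
        / ((Smin : ℤ) : ℝ) := by
    field_simp
  rw [e]
  push_cast at h01'
  have := mul_le_mul_of_nonneg_left hlog h01'
  calc ((α1 : ℝ) - (α0 : ℝ)) * Real.log (1 + ((Smin : ℤ) : ℝ) / 2 ^ 40 * (((Lm : ℤ) : ℝ) / 2 ^ 40) / (((Vlo : ℤ) : ℝ) / 2 ^ 40))
        / ((Smin : ℤ) : ℝ)
      ≤ ((α1 : ℝ) - (α0 : ℝ)) * (((logUpZ (cdivZ (Smin * Lm) Vlo) : ℤ) : ℝ) / 2 ^ 40) / ((Smin : ℤ) : ℝ) :=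
        div_le_div_of_nonneg_right this hS'.le
    _ = ((α1 : ℝ) - (α0 : ℝ)) * ((logUpZ (cdivZ (Smin * Lm) Vlo) : ℤ) : ℝ) / ((Smin : ℤ) : ℝ) / 2 ^ 40 := by ring

/-! ## §2 The core theorem of the 2-D variant -/

/-- **VARIANT AB CORE**.  Piece data: `α m = linGridZ αLo αUp MA m`, `Smin m = min (sDnZ (α m)) (sDnZ (α (m+1)))`,
`Lm m = extentZ far (α m) (α (m+1)) βLo βUp`.  Hypotheses: (H1) for `x, y` in the closed cell and `cos (x + sx)` in piece `m`, the two-shell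
integrand at `pt x y` is `≤ cres (!far) (mpos x) (Smin m/2^40) (Vlo/2^40) (cos (y + sy))`; (H2) ordinate cosine range `[βLo, βUp]/2^40` and
sine floor `τy/10⁴`; (H2x) abscissa cosine range `[αLo, αUp]/2^40` and sine floor `τx/10⁴`; (H3) for `cos (x + sx)` in piece `m` the
crescent extent of `mpos x` is `≤ Lm m/2^40`; `0 < Smin m` for every piece; `0 < Vlo`, `0 < τx`, `0 < τy`, `αLo ≤ αUp`.  Then
`CeilValid a b c d (cdivZ (2^30·10⁸·Σ_m bdryPieceUp (!far) Vlo (α m) (α (m+1)) βLo βUp) (τx·τy·D))`. -/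
theorem Params.hyperbolaAB_core (P : Params) (hP : P.admissible = true) {a b c d : ℤ} (hab : a < b) (hcd : c < d) (far : Bool)
    {αLo αUp βLo βUp Vlo : ℤ} {τx τy : ℕ} {sx sy : ℝ} {mpos : ℝ → ℝ} (hαα : αLo ≤ αUp) (hV : 0 < Vlo) (hτx : 0 < τx) (hτy : 0 < τy)
    (hSmin : ∀ m, m < MA → 0 < min (P.sDnZ (linGridZ αLo αUp MA m)) (P.sDnZ (linGridZ αLo αUp MA (m + 1))))
    (H1 : ∀ x ∈ Icc ((a : ℝ) / (P.U : ℝ)) ((b : ℝ) / (P.U : ℝ)), ∀ y ∈ Icc ((c : ℝ) / (P.U : ℝ)) ((d : ℝ) / (P.U : ℝ)), ∀ m, m < MA →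
      ((linGridZ αLo αUp MA m : ℤ) : ℝ) / 2 ^ 40 ≤ Real.cos (x + sx) → Real.cos (x + sx) ≤ ((linGridZ αLo αUp MA (m + 1) : ℤ) : ℝ) / 2 ^ 40 →
      P.integrand (pt x y) ≤ cres (!far) (mpos x)
        (((min (P.sDnZ (linGridZ αLo αUp MA m)) (P.sDnZ (linGridZ αLo αUp MA (m + 1))) : ℤ) : ℝ) / 2 ^ 40)
        (((Vlo : ℤ) : ℝ) / 2 ^ 40) (Real.cos (y + sy)))
    (H2 : ∀ y ∈ Icc ((c : ℝ) / (P.U : ℝ)) ((d : ℝ) / (P.U : ℝ)),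
      (((βLo : ℤ) : ℝ) / 2 ^ 40 ≤ Real.cos (y + sy) ∧ Real.cos (y + sy) ≤ ((βUp : ℤ) : ℝ) / 2 ^ 40) ∧
        (τy : ℝ) / 10 ^ 4 ≤ |Real.sin (y + sy)|)
    (H2x : ∀ x ∈ Icc ((a : ℝ) / (P.U : ℝ)) ((b : ℝ) / (P.U : ℝ)),
      (((αLo : ℤ) : ℝ) / 2 ^ 40 ≤ Real.cos (x + sx) ∧ Real.cos (x + sx) ≤ ((αUp : ℤ) : ℝ) / 2 ^ 40) ∧
        (τx : ℝ) / 10 ^ 4 ≤ |Real.sin (x + sx)|)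
    (H3 : ∀ x ∈ Icc ((a : ℝ) / (P.U : ℝ)) ((b : ℝ) / (P.U : ℝ)), ∀ m, m < MA →
      ((linGridZ αLo αUp MA m : ℤ) : ℝ) / 2 ^ 40 ≤ Real.cos (x + sx) → Real.cos (x + sx) ≤ ((linGridZ αLo αUp MA (m + 1) : ℤ) : ℝ) / 2 ^ 40 →
      cresExtentLE (!far) (mpos x) (((βLo : ℤ) : ℝ) / 2 ^ 40) (((βUp : ℤ) : ℝ) / 2 ^ 40)
        (((P.extentZ far (linGridZ αLo αUp MA m) (linGridZ αLo αUp MA (m + 1)) βLo βUp : ℤ) : ℝ) / 2 ^ 40)) :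
    P.CeilValid a b c d (cdivZ (2 ^ 30 * 10 ^ 8 *
      ((List.range MA).map fun m => P.bdryPieceUp (!far) Vlo (linGridZ αLo αUp MA m) (linGridZ αLo αUp MA (m + 1)) βLo βUp).sum)
      ((τx : ℤ) * (τy : ℤ) * D)) := by
  obtain ⟨htpD, hmuD, hU, -, -⟩ := P.admissible_facts hP
  have hU' : (0 : ℝ) < (P.U : ℝ) := by exact_mod_cast hU
  have hMA : 0 < MA := by decide
  have hV' : (0 : ℝ) < ((Vlo : ℤ) : ℝ) / 2 ^ 40 := div_pos (by exact_mod_cast hV) (by positivity)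
  have hτx' : (0 : ℝ) < (τx : ℝ) / 10 ^ 4 := div_pos (by exact_mod_cast hτx) (by positivity)
  have hτy' : (0 : ℝ) < (τy : ℝ) / 10 ^ 4 := div_pos (by exact_mod_cast hτy) (by positivity)
  have hx01 : (a : ℝ) / (P.U : ℝ) ≤ (b : ℝ) / (P.U : ℝ) := div_le_div_of_nonneg_right (by exact_mod_cast hab.le) hU'.le
  have hy01 : (c : ℝ) / (P.U : ℝ) ≤ (d : ℝ) / (P.U : ℝ) := div_le_div_of_nonneg_right (by exact_mod_cast hcd.le) hU'.le
  -- abbreviations for the piece data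
  set α : ℕ → ℤ := fun m => linGridZ αLo αUp MA m with hα
  set Sm : ℕ → ℤ := fun m => min (P.sDnZ (α m)) (P.sDnZ (α (m + 1))) with hSm
  set Lm : ℕ → ℤ := fun m => P.extentZ far (α m) (α (m + 1)) βLo βUp with hLm
  set A : ℕ → ℝ := fun m => ((α m : ℤ) : ℝ) / 2 ^ 40 with hA
  set K : ℕ → ℝ := fun m => ((τy : ℝ) / 10 ^ 4)⁻¹ * (((((Sm m : ℤ) : ℝ) / 2 ^ 40))⁻¹ *
    Real.log (1 + ((Sm m : ℤ) : ℝ) / 2 ^ 40 * (((Lm m : ℤ) : ℝ) / 2 ^ 40) / (((Vlo : ℤ) : ℝ) / 2 ^ 40))) with hK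
  have hLm0 : ∀ m, 0 ≤ Lm m := fun m => by simp only [hLm, Params.extentZ]; exact le_max_left _ _
  have hSm' : ∀ m, m < MA → (0 : ℝ) < ((Sm m : ℤ) : ℝ) / 2 ^ 40 := fun m hm =>
    div_pos (by exact_mod_cast hSmin m hm) (by positivity)
  have hK0 : ∀ m, m < MA → 0 ≤ K m := by
    intro m hm
    have := (log_piece_le (hSmin m hm) hV (hLm0 m)).1
    have h2 := hSm' m hm
    simp only [hK]
    exact mul_nonneg (inv_nonneg.mpr hτy'.le) (mul_nonneg (inv_nonneg.mpr h2.le) this)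
  have hmono : ∀ m, m < MA → A m ≤ A (m + 1) := fun m _ =>
    div_le_div_of_nonneg_right (by exact_mod_cast linGridZ_mono hαα hMA (Nat.le_succ m)) (by positivity)
  have hA0 : A 0 = ((αLo : ℤ) : ℝ) / 2 ^ 40 := by simp only [hA, hα, linGridZ_zero]
  have hAN : A MA = ((αUp : ℤ) : ℝ) / 2 ^ 40 := by simp only [hA, hα, linGridZ_last αLo αUp hMA]
  -- integrability on the cell (F ≤ 1/V through some piece)
  have hdomV : ∀ x ∈ Icc ((a : ℝ) / (P.U : ℝ)) ((b : ℝ) / (P.U : ℝ)), ∀ y ∈ Icc ((c : ℝ) / (P.U : ℝ)) ((d : ℝ) / (P.U : ℝ)),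
      P.integrand (pt x y) ≤ 1 / (((Vlo : ℤ) : ℝ) / 2 ^ 40) := by
    intro x hx y hy
    obtain ⟨⟨hc0, hc1⟩, -⟩ := H2x x hx
    rw [← hA0] at hc0; rw [← hAN] at hc1
    obtain ⟨m, hm, hm0, hm1⟩ := exists_piece hMA hmono hc0 hc1
    exact (H1 x hx y hy m hm hm0 hm1).trans (cres_bounds (!far) (hSm' m hm).le hV' _).2
  have hbd : ∀ p ∈ P.cellSet a b c d, ‖P.integrand p‖ ≤ 1 / (((Vlo : ℤ) : ℝ) / 2 ^ 40) := by
    intro p hp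
    obtain ⟨h0, h1⟩ := P.mem_Icc_of_mem_cellSet hp
    have hpt : pt (p 0) (p 1) = p := by
      ext i; fin_cases i
      · exact pt_apply_zero _ _
      · exact pt_apply_one _ _
    rw [Real.norm_of_nonneg (P.integrand_nonneg p), ← hpt]
    exact hdomV _ h0 _ h1
  have hint : IntegrableOn P.integrand (P.cellSet a b c d) volume :=
    Measure.integrableOn_of_bounded (P.volume_cellSet_lt_top a b c d).ne P.measurable_integrand.aestronglyMeasurable
      (ae_restrict_of_forall_mem (P.measurableSet_cellSet a b c d) hbd)
  refine ⟨hint, ?_⟩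
  rw [P.cellInt_eq_Icc_Icc hU hab.le hcd.le hint]
  -- the ordinate strip on piece m
  have hinjy : InjOn Real.cos (Icc ((c : ℝ) / (P.U : ℝ) + sy) ((d : ℝ) / (P.U : ℝ) + sy)) := by
    apply injOn_cos_of_sin_ne_zero
    intro y hy
    have h := (H2 (y - sy) ⟨by linarith [hy.1], by linarith [hy.2]⟩).2
    rw [sub_add_cancel] at h
    intro h0; rw [h0, abs_zero] at h; linarith
  have hinjx : InjOn Real.cos (Icc ((a : ℝ) / (P.U : ℝ) + sx) ((b : ℝ) / (P.U : ℝ) + sx)) := by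
    apply injOn_cos_of_sin_ne_zero
    intro x hx
    have h := (H2x (x - sx) ⟨by linarith [hx.1], by linarith [hx.2]⟩).2
    rw [sub_add_cancel] at h
    intro h0; rw [h0, abs_zero] at h; linarith
  have hFi : ∀ x ∈ Icc ((a : ℝ) / (P.U : ℝ)) ((b : ℝ) / (P.U : ℝ)),
      IntegrableOn (fun y => P.integrand (pt x y)) (Icc ((c : ℝ) / (P.U : ℝ)) ((d : ℝ) / (P.U : ℝ))) volume := by
    intro x hx
    exact Measure.integrableOn_of_bounded (measure_Icc_lt_top (a := (c : ℝ) / (P.U : ℝ)) (b := (d : ℝ) / (P.U : ℝ))).ne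
      (P.measurable_integrand.comp (measurable_pt_right x)).aestronglyMeasurable
      (ae_restrict_of_forall_mem measurableSet_Icc fun y hy => by
        rw [Real.norm_of_nonneg (P.integrand_nonneg _)]; exact hdomV x hx y hy)
  have hstrip : ∀ x ∈ Icc ((a : ℝ) / (P.U : ℝ)) ((b : ℝ) / (P.U : ℝ)), ∀ m, m < MA → A m ≤ Real.cos (x + sx) →
      Real.cos (x + sx) ≤ A (m + 1) → ∫ y in Icc ((c : ℝ) / (P.U : ℝ)) ((d : ℝ) / (P.U : ℝ)), P.integrand (pt x y) ≤ K m := by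
    intro x hx m hm hm0 hm1
    exact strip_inner_le (!far) (f := fun y => P.integrand (pt x y)) hy01 hτy' (hSm' m hm) hV'
      (div_nonneg (by exact_mod_cast hLm0 m) (by positivity)) (fun y hy => (H2 y hy).2) (fun y hy => (H2 y hy).1) hinjy
      (H3 x hx m hm hm0 hm1) (hFi x hx) (fun y hy => H1 x hx y hy m hm hm0 hm1)
  -- the piecewise strip lemma in the abscissa
  have hpieces := pieces_strip_lemma (A := A) (K := K) hMA hmono hK0 hx01 hτx' (fun x hx => (H2x x hx).2)
    (fun x hx => by rw [hA0, hAN]; exact (H2x x hx).1) hinjx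
    (fun x _ => setIntegral_nonneg measurableSet_Icc fun y _ => P.integrand_nonneg _) hstrip
  -- per-piece rounding and the total
  have hsum : ∑ m ∈ range MA, K m * (A (m + 1) - A m) ≤ ((τy : ℝ) / 10 ^ 4)⁻¹ *
      (((∑ m ∈ range MA, P.bdryPieceUp (!far) Vlo (α m) (α (m + 1)) βLo βUp : ℤ) : ℝ) / 2 ^ 40) := by
    rw [Int.cast_sum, sum_div, mul_sum]
    refine sum_le_sum fun m hm => ?_
    have hm' := mem_range.mp hm
    have hpiece := piece_rounding (linGridZ_mono hαα hMA (Nat.le_succ m)) (hSmin m hm') hV (hLm0 m)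
    rw [P.bdryPieceUp_eq, if_pos (hSmin m hm')]
    have e : K m * (A (m + 1) - A m) = ((τy : ℝ) / 10 ^ 4)⁻¹ * (((α (m + 1) - α m : ℤ) : ℝ) / 2 ^ 40 *
        (((((Sm m : ℤ) : ℝ) / 2 ^ 40))⁻¹ * Real.log (1 + ((Sm m : ℤ) : ℝ) / 2 ^ 40 * (((Lm m : ℤ) : ℝ) / 2 ^ 40) /
          (((Vlo : ℤ) : ℝ) / 2 ^ 40)))) := by
      simp only [hK, hA]; push_cast; ring
    rw [e]
    exact mul_le_mul_of_nonneg_left hpiece (inv_nonneg.mpr hτy'.le)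
  -- assemble
  have htot0 : 0 ≤ ∑ m ∈ range MA, P.bdryPieceUp (!far) Vlo (α m) (α (m + 1)) βLo βUp := by
    refine sum_nonneg fun m hm => ?_
    have hm' := mem_range.mp hm
    rw [P.bdryPieceUp_eq, if_pos (hSmin m hm')]
    refine cdivZ_nonneg (mul_nonneg (sub_nonneg.mpr (linGridZ_mono hαα hMA (Nat.le_succ m))) ?_) (hSmin m hm')
    have := (log_piece_le (hSmin m hm') hV (hLm0 m)).1.trans (log_piece_le (hSmin m hm') hV (hLm0 m)).2
    have h2 : (0 : ℝ) ≤ ((logUpZ (cdivZ (Sm m * Lm m) Vlo) : ℤ) : ℝ) := by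
      have h3 := mul_nonneg this (by positivity : (0:ℝ) ≤ 2 ^ 40); rwa [div_mul_cancel₀ _ (by positivity)] at h3
    exact_mod_cast h2
  rw [list_range_map_sum]
  have hden : 0 < (τx : ℤ) * (τy : ℤ) * D := by rw [D]; positivity
  have rc := div_le_cdivZ (2 ^ 30 * 10 ^ 8 * ∑ m ∈ range MA, P.bdryPieceUp (!far) Vlo (α m) (α (m + 1)) βLo βUp)
    ((τx : ℤ) * (τy : ℤ) * D) hden
  have rc' := (Rat.cast_le (K := ℝ)).mpr rc
  simp only [Rat.cast_div, Rat.cast_intCast] at rc'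
  refine le_trans ?_ rc'
  have hdenR : (0 : ℝ) < (((τx : ℤ) * (τy : ℤ) * D : ℤ) : ℝ) := by exact_mod_cast hden
  rw [le_div_iff₀ hdenR]
  have hDR : ((D : ℤ) : ℝ) = 2 ^ 40 := by rw [D]; push_cast; norm_num
  simp only [Int.cast_mul, Int.cast_pow, Int.cast_ofNat, Int.cast_natCast, hDR]
  -- 2^30 ∫∫ ≤ 2^30 τx'⁻¹ Σ K ΔA ≤ 2^30 τx'⁻¹ τy'⁻¹ total/D  and  × (τx τy D) = 2^30 10^8 total
  have h1 := mul_le_mul_of_nonneg_left (hpieces.trans (mul_le_mul_of_nonneg_left hsum (inv_nonneg.mpr hτx'.le)))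
    (by positivity : (0 : ℝ) ≤ 2 ^ 30 * ((τx : ℝ) * (τy : ℝ) * 2 ^ 40))
  have e : 2 ^ 30 * ((τx : ℝ) * (τy : ℝ) * 2 ^ 40) * (((τx : ℝ) / 10 ^ 4)⁻¹ * (((τy : ℝ) / 10 ^ 4)⁻¹ *
      (((∑ m ∈ range MA, P.bdryPieceUp (!far) Vlo (α m) (α (m + 1)) βLo βUp : ℤ) : ℝ) / 2 ^ 40)))
      = 2 ^ 30 * 10 ^ 8 * ((∑ m ∈ range MA, P.bdryPieceUp (!far) Vlo (α m) (α (m + 1)) βLo βUp : ℤ) : ℝ) := by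
    field_simp
  rw [e] at h1
  linarith

end Summit.HubbardSuperconductivity.HubbardSuperconductivity.Theorems.KlLindhardEnclosure

end
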